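import Mathlib.Data.Int.Basic
import HarnessLib

/-!
# Borel-fixed `(110)`-candidates of `⟨3,3,3⟩`, V: the kernel test procedure (computation only)

Topic `Literature/Computability/AlgebraicComplexity`. Executable half (no theorems beyond `rfl`s) of
the `(210)`/`(120)` tests of Conner–Harper–Landsberg 2023, §3/§6 for the Borel-fixed candidates of
`⟨3,3,3⟩`, in the block-model form of `BorderRankMatMulThreeCover.lean`, written for evaluation by
the KERNEL (`decide +kernel`): plain `List`/`ℕ`/`ℤ` recursion, no `Finset`, no `Matrix`.

A profile is a list of nine block codes `(R, δ)` (block `(j,k)` at position `3j + k`); its model is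
spanned by root units and block-diagonal vectors (`MatMul3.Ker.mvecs`; the free diagonal type has
the four variants `⟨1, (0,α,β)⟩`, `⟨1,e₀⟩`, `⟨1,e₁⟩`, `⟨1,e₂⟩`). Entries are linear forms
`c + aα + bβ` (`MatMul3.Ker.LF`). The `(210)`-test images of a model vector `v` and an output
coordinate `s₀` are the skew-symmetrisations `[x₀ = s₀] v(x₁,x₂) - [x₁ = s₀] v(x₀,x₂)`
(`MatMul3.Ker.entryI`; `entryK` for `(120)`); they are weight vectors, so images of distinct weights
have disjoint supports and ranks add over weight groups. A CERTIFICATE for a test is a list of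
groups `(columns, rows)` with a non-zero integer minor (or, for the one parametric column of the
free variant, a minor `αA + βB` with `(A,B) ∈ {(c,0),(0,c),(c,-c)}`, non-zero when
`α, β, α - β ≠ 0`); `MatMul3.Ker.checkCert` validates it and returns the certified rank, whence the
bound `9·|vectors| - rank` on the test dimension. `MatMul3.Ker.searchCert` FINDS certificates
(Gaussian elimination modulo a prime; untrusted), and `MatMul3.Ker.verdict` decides whether every
variant of a profile fails a test with bound `≤ 15`. Soundness is `BorderRankMatMulThreeKernelSound.lean`.

## References

* A. Conner, A. Harper, J. M. Landsberg, *New lower bounds for matrix multiplication and `det₃`*,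
  Forum Math. Pi 11 (2023) e17, arXiv:1911.07981 — §3 (the tests), §6. [ConnerHarperLandsberg2023]
-/

namespace Literature.Computability.AlgebraicComplexity

namespace BorderApolarity

namespace MatMul3

namespace Ker

/-! ## Linear forms `c + aα + bβ` -/

/-- A linear form `c + a·α + b·β` in the two parameters of the free diagonal `(0, α, β)`.
[folklore] -/
abbrev LF : Type := ℤ × ℤ × ℤ

/-- Addition of linear forms. [folklore] -/
def LF.add (x y : LF) : LF := (x.1 + y.1, x.2.1 + y.2.1, x.2.2 + y.2.2)

/-- Negation of a linear form. [folklore] -/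
def LF.neg (x : LF) : LF := (-x.1, -x.2.1, -x.2.2)

/-- The constant linear form. [folklore] -/
def LF.const (c : ℤ) : LF := (c, 0, 0)

/-- Is the form constant? [folklore] -/
def LF.isConst (x : LF) : Bool := x.2.1 == 0 && x.2.2 == 0

/-! ## Weights and block models in codes -/

/-- `φ = (0,1,3)` on `i`. [cite: ConnerHarperLandsberg2023, §2.5] -/
def phiN (i : ℕ) : ℕ := if i = 0 then 0 else if i = 1 then 1 else 3

/-- `θ = (0,7,21)` on `j`. [cite: ConnerHarperLandsberg2023, §2.5] -/
def thetaN (j : ℕ) : ℕ := if j = 0 then 0 else if j = 1 then 7 else 21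

/-- `ψ = (0,49,147)` on `k`. [cite: ConnerHarperLandsberg2023, §2.5] -/
def psiN (k : ℕ) : ℕ := if k = 0 then 0 else if k = 1 then 49 else 147

/-- Weight of the output coordinate code `a = 3i + k`. [cite: ConnerHarperLandsberg2023, §2.5] -/
def wAN (a : ℕ) : ℕ := phiN (a / 3) + psiN (a % 3)

/-- Weight of the coordinate code `b = 3i' + j`. [cite: ConnerHarperLandsberg2023, §2.5] -/
def wBN (b : ℕ) : ℕ := (3 - phiN (b / 3)) + thetaN (b % 3)

/-- Diagonal type code of a block `(R, δ)`: `0 = Id`, `1 = ⟨1,e₀⟩`, `2 = ⟨1,e₂⟩`, `3 = ⟨1,e₀-e₁⟩`,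
`4 = ⟨1,e₁-e₂⟩`, `5 = free`, `6 = all` (as `MatMul3.dtypeOf`). [cite: ConnerHarperLandsberg2023, §6] -/
def dcode (R : List (ℕ × ℕ)) (δ : ℕ) : ℕ :=
  if δ = 0 then 0 else if 2 ≤ δ then 6 else if R.contains (1, 0) then 3
  else if R.contains (2, 1) then 4 else if !(R.contains (1, 2)) then 1
  else if !(R.contains (0, 1)) then 2 else 5

/-- Diagonal generators of a type code under a variant (`0 = generic`, `1,2,3 = ⟨1,e₀⟩,⟨1,e₁⟩,⟨1,e₂⟩`
for the free type). [cite: ConnerHarperLandsberg2023, §6] -/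
def dgensN (t var : ℕ) : List (List LF) :=
  let one : List LF := [(1,0,0), (1,0,0), (1,0,0)]
  let e0 : List LF := [(1,0,0), (0,0,0), (0,0,0)]
  let e1 : List LF := [(0,0,0), (1,0,0), (0,0,0)]
  let e2 : List LF := [(0,0,0), (0,0,0), (1,0,0)]
  if t = 0 then [one]
  else if t = 6 then [e0, e1, e2]
  else if t = 1 then [one, e0]
  else if t = 2 then [one, e2]
  else if t = 3 then [one, [(1,0,0), (-1,0,0), (0,0,0)]]
  else if t = 4 then [one, [(0,0,0), (1,0,0), (-1,0,0)]]
  else -- free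
    if var = 0 then [one, [(0,0,0), (0,1,0), (0,0,1)]]
    else if var = 1 then [one, e0] else if var = 2 then [one, e1] else [one, e2]

/-- A model vector: a root unit `(jk, i, i')` or a diagonal vector `(jk, d)` of block `jk = 3j+k`.
[cite: ConnerHarperLandsberg2023, §6] -/
inductive MVec
  | unit (jk i i' : ℕ)
  | diag (jk : ℕ) (d : List LF)

/-- Value of a model vector at the pair coordinate codes `(a, b) = (3i+k', 3i'+j')`. [folklore] -/
def MVec.val : MVec → ℕ → ℕ → LF
  | .unit jk i i', a, b =>
      if a % 3 = jk % 3 ∧ b % 3 = jk / 3 ∧ a / 3 = i ∧ b / 3 = i' then (1,0,0) else (0,0,0)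
  | .diag jk d, a, b =>
      if a % 3 = jk % 3 ∧ b % 3 = jk / 3 ∧ a / 3 = b / 3 then d.getD (a / 3) (0,0,0) else (0,0,0)

/-- Weight of a model vector (a weight vector). [folklore] -/
def MVec.wt : MVec → ℕ
  | .unit jk i i' => wAN (3 * i + jk % 3) + wBN (3 * i' + jk / 3)
  | .diag jk _ => wAN (jk % 3) + wBN (jk / 3)

/-- Is the model vector parametric (the free generic diagonal)? [folklore] -/
def MVec.isPar : MVec → Bool
  | .unit _ _ _ => false
  | .diag _ d => !(d.all LF.isConst)

/-- The model vectors of a profile (nine block codes `(R, δ)`) under a variant.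
[cite: ConnerHarperLandsberg2023, §6] -/
def mvecs (prof : List (List (ℕ × ℕ) × ℕ)) (var : ℕ) : List MVec :=
  (List.range 9).flatMap fun jk =>
    let b := prof.getD jk ([], 0)
    ((dgensN (dcode b.1 b.2) var).map fun d => MVec.diag jk d) ++
      (b.1.map fun ii' => MVec.unit jk ii'.1 ii'.2)

/-! ## Test entries -/

/-- Entry of the `(210)`-test image of `(s₀, v)` at the row `(x₀, x₁, x₂)`:
`[x₀ = s₀] v(x₁,x₂) - [x₁ = s₀] v(x₀,x₂)`. [cite: ConnerHarperLandsberg2023, §3] -/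
def entryI (v : MVec) (s0 x0 x1 x2 : ℕ) : LF :=
  LF.add (if x0 = s0 then v.val x1 x2 else (0,0,0)) (if x1 = s0 then (v.val x0 x2).neg else (0,0,0))

/-- Entry of the `(120)`-test image of `(s₀, v)` at the row `(x₀, x₁, x₂)`:
`[x₂ = s₀] v(x₀,x₁) - [x₁ = s₀] v(x₀,x₂)`. [cite: ConnerHarperLandsberg2023, §3] -/
def entryK (v : MVec) (s0 x0 x1 x2 : ℕ) : LF :=
  LF.add (if x2 = s0 then v.val x0 x1 else (0,0,0)) (if x1 = s0 then (v.val x0 x2).neg else (0,0,0))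

/-- Test entry (`tk = false`: `(210)`, `true`: `(120)`). [folklore] -/
def entry (tk : Bool) (v : MVec) (s0 : ℕ) (x : ℕ × ℕ × ℕ) : LF :=
  if tk then entryK v s0 x.1 x.2.1 x.2.2 else entryI v s0 x.1 x.2.1 x.2.2

/-- Weight of the column `(s₀, v)`. [folklore] -/
def colWt (tk : Bool) (v : MVec) (s0 : ℕ) : ℕ := (if tk then wBN s0 else wAN s0) + v.wt

/-! ## Integer determinants and the certificate checker -/

/-- Remove the `j`-th element of a list. [folklore] -/
def dropAt {α : Type} : List α → ℕ → List α
  | [], _ => []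
  | _ :: l, 0 => l
  | a :: l, n + 1 => a :: dropAt l n

/-- Laplace expansion along the first row (fuel-bounded; matrices as lists of rows). [folklore] -/
def detL : ℕ → List (List ℤ) → ℤ
  | 0, _ => 1
  | _ + 1, [] => 1
  | n + 1, row :: rows =>
      ((List.range row.length).map fun j =>
        (if j % 2 = 0 then 1 else -1) * row.getD j 0 * detL n (rows.map fun r => dropAt r j)).sum

/-- A certificate group: the test, its columns `(s₀, vector index)`, its rows `(x₀,x₁,x₂)`, and
whether the LAST column is the parametric one. [folklore] -/
structure CGroup where
  /-- column labels `(s₀, m)` -/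
  cols : List (ℕ × ℕ)
  /-- row coordinates -/
  rows : List (ℕ × ℕ × ℕ)
  /-- parametric last column? -/
  par : Bool

/-- The matrix of a group: constant parts of the entries, except that in the LAST column the part
`part ∈ {0,1,2}` (constant, `α`-, `β`-coefficient) is taken (column-linearity of `det`). [folklore] -/
def groupMatrix (tk : Bool) (vs : List MVec) (g : CGroup) (part : ℕ) : List (List ℤ) :=
  let n := g.cols.length
  g.rows.map fun x => (List.range n).map fun t =>
    let sm := g.cols.getD t (0, 0)
    let e := entry tk (vs.getD sm.2 (.unit 0 0 0)) sm.1 x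
    if t + 1 = n then (if part = 0 then e.1 else if part = 1 then e.2.1 else e.2.2) else e.1

/-- All entries of all but (possibly) the last column are constant. [folklore] -/
def constCols (tk : Bool) (vs : List MVec) (g : CGroup) : Bool :=
  let cs := if g.par then g.cols.dropLast else g.cols
  g.rows.all fun x => cs.all fun sm => (entry tk (vs.getD sm.2 (.unit 0 0 0)) sm.1 x).isConst

/-- Admissible shapes `(A, B)` of a parametric minor `αA + βB`: `(c,0)`, `(0,c)`, `(c,-c)`, `c ≠ 0`
(non-zero whenever `α, β, α - β ≠ 0`). [folklore] -/
def shapeOK (a b : ℤ) : Bool := (a != 0 && b == 0) || (a == 0 && b != 0) || (a != 0 && a == -b)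

/-- The acceptance condition of one group: square, constant columns (but possibly the last), and
a non-zero constant minor (case A) or, in the generic variant, a parametric minor `αA + βB` of
admissible shape with vanishing constant part (case B). [folklore] -/
def groupCond (tk : Bool) (vs : List MVec) (gen : Bool) (g : CGroup) : Bool :=
  let k := g.rows.length
  (g.cols.length == k) && constCols tk vs g &&
    (if g.par then
      gen && (detL k (groupMatrix tk vs g 0) == 0) &&
        shapeOK (detL k (groupMatrix tk vs g 1)) (detL k (groupMatrix tk vs g 2))
     else detL k (groupMatrix tk vs g 0) != 0)

/-- The certified rank of one group: `k` if accepted, else `0`. [folklore] -/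
def groupRank (tk : Bool) (vs : List MVec) (gen : Bool) (g : CGroup) : ℕ :=
  if groupCond tk vs gen g then g.rows.length else 0

/-- Columns of a group have a common weight; returns it (or `none`). [folklore] -/
def groupWt (tk : Bool) (vs : List MVec) (g : CGroup) : Option ℕ :=
  match g.cols with
  | [] => none
  | sm :: rest =>
      let w := colWt tk (vs.getD sm.2 (.unit 0 0 0)) sm.1
      if rest.all fun sm' => colWt tk (vs.getD sm'.2 (.unit 0 0 0)) sm'.1 = w then some w else none

/-- Column labels are in range. [folklore] -/
def colsOK (vs : List MVec) (g : CGroup) : Bool :=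
  g.cols.all fun sm => sm.1 < 9 ∧ sm.2 < vs.length

/-- Weights of the groups of a certificate (`0` for an ill-formed group). [folklore] -/
def certWts (tk : Bool) (vs : List MVec) (cert : List CGroup) : List ℕ :=
  cert.map fun g => match groupWt tk vs g with | some w => w | none => 0

/-- Strictly increasing list of naturals. [folklore] -/
def strictInc : List ℕ → Bool
  | [] => true
  | [_] => true
  | a :: b :: rest => decide (a < b) && strictInc (b :: rest)

/-- Weight of a row coordinate `(x₀,x₁,x₂)` of the test `tk`. [folklore] -/
def rowWt (tk : Bool) (x : ℕ × ℕ × ℕ) : ℕ :=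
  if tk then wAN x.1 + wBN x.2.1 + wBN x.2.2 else wAN x.1 + wAN x.2.1 + wBN x.2.2

/-- Rows of a group are coordinates `< 9` of the group's weight. [folklore] -/
def rowsOK (tk : Bool) (vs : List MVec) (g : CGroup) : Bool :=
  match groupWt tk vs g with
  | none => false
  | some w => g.rows.all fun x => x.1 < 9 ∧ x.2.1 < 9 ∧ x.2.2 < 9 ∧ rowWt tk x = w

/-- **The checker, structural part**: valid column labels, every group has a common weight shared by
its rows, and the group weights strictly increase (so they are pairwise distinct). [folklore] -/
def certOK (tk : Bool) (vs : List MVec) (cert : List CGroup) : Bool :=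
  (cert.all fun g => colsOK vs g && rowsOK tk vs g) && strictInc (certWts tk vs cert)

/-- **The checker, rank part**: the sum of the certified group ranks. [folklore] -/
def certRank (tk : Bool) (vs : List MVec) (gen : Bool) (cert : List CGroup) : ℕ :=
  (cert.map (groupRank tk vs gen)).sum

/-- The certified upper bound `9·|vectors| - rank` on the test dimension (no credit for an
ill-formed certificate). [folklore] -/
def boundOf (tk : Bool) (vs : List MVec) (gen : Bool) (cert : List CGroup) : ℕ :=
  if certOK tk vs cert then 9 * vs.length - certRank tk vs gen cert else 9 * vs.length

/-! ## The certificate search (untrusted) -/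

/-- The prime used for the pivot search. [folklore] -/
def PR : ℕ := 65521

/-- Sparse entries of the column `(s₀, v)`: the rows where it may be non-zero, with the entry.
[folklore] -/
def colEntries (tk : Bool) (v : MVec) (s0 : ℕ) : List ((ℕ × ℕ × ℕ) × LF) :=
  -- support of `v`: at most three pair coordinates, found by scanning its block
  let jk := match v with | .unit jk _ _ => jk | .diag jk _ => jk
  let pairs := (List.range 3).flatMap fun i => (List.range 3).filterMap fun i' =>
    let a := 3 * i + jk % 3
    let b := 3 * i' + jk / 3
    let e := v.val a b
    if e == (0,0,0) then none else some (a, b)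
  let rows := pairs.flatMap fun ab =>
    if tk then [(ab.1, ab.2, s0), (ab.1, s0, ab.2)] else [(s0, ab.1, ab.2), (ab.1, s0, ab.2)]
  let rows := rows.eraseDups
  rows.filterMap fun x =>
    let e := entry tk v s0 x
    if e == (0,0,0) then none else some (x, e)

/-- Modular exponentiation by repeated squaring (fuel = number of bits). [folklore] -/
def powMod (fuel a e : ℕ) : ℕ :=
  match fuel with
  | 0 => 1
  | fuel + 1 =>
      if e = 0 then 1 else
        let h := powMod fuel (a * a % PR) (e / 2)
        if e % 2 = 1 then h * a % PR else h

/-- Modular inverse by Fermat. [folklore] -/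
def invMod (a : ℕ) : ℕ := powMod 20 (a % PR) (PR - 2)

/-- One elimination pass: given rows (as association lists over column positions, mod `PR`),
select pivots greedily column by column; returns the chosen `(row index, column position)` pairs.
[folklore] -/
def pivots (ncols : ℕ) (mat : List (List ℕ)) : List (ℕ × ℕ) :=
  -- mat : dense rows of length ncols with entries mod PR
  let rec loop (fuel : ℕ) (t : ℕ) (rows : List (ℕ × List ℕ)) (acc : List (ℕ × ℕ)) : List (ℕ × ℕ) :=
    match fuel with
    | 0 => acc
    | fuel + 1 =>
      if t ≥ ncols then acc else
      match rows.find? fun ir => ir.2.getD t 0 % PR ≠ 0 with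
      | none => loop fuel (t + 1) rows acc
      | some (ip, prow) =>
          let inv := invMod (prow.getD t 0 % PR)
          let rows' := (rows.filter fun ir => ir.1 ≠ ip).map fun ir =>
            let f := ir.2.getD t 0 * inv % PR
            if f = 0 then ir else
              (ir.1, (List.range ncols).map fun tt => (ir.2.getD tt 0 + PR * PR - f * prow.getD tt 0) % PR)
          loop fuel (t + 1) rows' ((ip, t) :: acc)
  loop (ncols + 1) 0 ((List.range mat.length).zip mat) []

/-- Build the certificate group for one weight class of columns. [folklore] -/
def searchGroup (tk : Bool) (vs : List MVec) (gen : Bool) (cols : List (ℕ × ℕ)) : Option CGroup :=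
  let constc := cols.filter fun sm => !(vs.getD sm.2 (.unit 0 0 0)).isPar
  let parc := cols.filter fun sm => (vs.getD sm.2 (.unit 0 0 0)).isPar
  -- rows occurring
  let rows := (cols.flatMap fun sm => (colEntries tk (vs.getD sm.2 (.unit 0 0 0)) sm.1).map Prod.fst).eraseDups
  let dense : List (List ℕ) := rows.map fun x => constc.map fun sm =>
    Int.toNat ((entry tk (vs.getD sm.2 (.unit 0 0 0)) sm.1 x).1 % (PR : ℤ))
  let piv := pivots constc.length dense
  let prow := piv.map Prod.fst
  let pcol := piv.map Prod.snd
  let baseRows := prow.map fun i => rows.getD i (0,0,0)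
  let baseCols := pcol.map fun t => constc.getD t (0,0)
  let gA : CGroup := ⟨baseCols, baseRows, false⟩
  if parc.isEmpty || !gen then (if baseCols.isEmpty then none else some gA)
  else
    -- try to extend by the parametric column and one more row
    let pc := parc.getD 0 (0,0)
    let cands := (List.range rows.length).filter fun i => !(prow.contains i)
    let try1 := cands.findSome? fun i =>
      let g : CGroup := ⟨baseCols ++ [pc], baseRows ++ [rows.getD i (0,0,0)], true⟩
      if groupRank tk vs gen g = g.rows.length then some g else none
    match try1 with
    | some g => some g
    | none => if baseCols.isEmpty then none else some gA

/-- Insert a column into weight-keyed buckets kept sorted by increasing weight. [folklore] -/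
def bucket (w : ℕ) (sm : ℕ × ℕ) : List (ℕ × List (ℕ × ℕ)) → List (ℕ × List (ℕ × ℕ))
  | [] => [(w, [sm])]
  | (w', l) :: rest =>
      if w = w' then (w', sm :: l) :: rest
      else if w < w' then (w, [sm]) :: (w', l) :: rest
      else (w', l) :: bucket w sm rest

/-- **The search**: group all columns `(s₀, m)` by weight and build a certificate group for each.
[folklore] -/
def searchCert (tk : Bool) (vs : List MVec) (gen : Bool) : List CGroup :=
  let cols := (List.range 9).flatMap fun s0 => (List.range vs.length).map fun m => (s0, m)
  let buckets := cols.foldl (fun acc sm => bucket (colWt tk (vs.getD sm.2 (.unit 0 0 0)) sm.1) sm acc) []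
  buckets.filterMap fun wl => searchGroup tk vs gen wl.2.reverse

/-! ## The verdict -/

/-- Number of free blocks of the profile. [folklore] -/
def freeCount (prof : List (List (ℕ × ℕ) × ℕ)) : ℕ := (prof.filter fun b => dcode b.1 b.2 = 5).length

/-- The certified bound of ONE test (`tk`) of a profile under a variant. [folklore] -/
def boundT (prof : List (List (ℕ × ℕ) × ℕ)) (var : ℕ) (tk : Bool) : ℕ :=
  let vs := mvecs prof var
  let gen := decide (0 < freeCount prof) && var == 0
  boundOf tk vs gen (searchCert tk vs gen)

/-- The certified test bounds of a profile under a variant: `(bound (210), bound (120))`. [folklore] -/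
def bounds (prof : List (List (ℕ × ℕ) × ℕ)) (var : ℕ) : ℕ × ℕ :=
  (boundT prof var false, boundT prof var true)

/-- **The verdict with hints** (which test to run for each variant): at most one free block, and
every variant of the profile has its hinted test of certified dimension `≤ 15`.
[cite: ConnerHarperLandsberg2023, §6] -/
def verdictH (prof : List (List (ℕ × ℕ) × ℕ)) (hints : List Bool) : Bool :=
  decide (freeCount prof ≤ 1) &&
    (let vars := if freeCount prof = 0 then [0] else [0, 1, 2, 3]
     vars.all fun var => decide (boundT prof var (hints.getD var false) ≤ 15))

/-- **The verdict** (both tests): every variant fails some test with certified dimension `≤ 15`.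
[cite: ConnerHarperLandsberg2023, §6] -/
def verdict (prof : List (List (ℕ × ℕ) × ℕ)) : Bool :=
  decide (freeCount prof ≤ 1) &&
    (let vars := if freeCount prof = 0 then [0] else [0, 1, 2, 3]
     vars.all fun var => let b := bounds prof var; decide (b.1 ≤ 15) || decide (b.2 ≤ 15))

end Ker


end MatMul3

end BorderApolarity

end Literature.Computability.AlgebraicComplexity
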